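import Mathlib
import HarnessLib
import Summits.HubbardSuperconductivity.HubbardSuperconductivity.Theorems.KLProgrammeKLRegimeEngineScaleZeroE4Package
import Summits.HubbardSuperconductivity.HubbardSuperconductivity.Theorems.KLProgrammeKLRegimeEngineScaleZeroE4OverlapSpaceExport
import Summits.HubbardSuperconductivity.HubbardSuperconductivity.Theorems.KLProgrammeKLRegimeEngineV8DefsU6

/-!
# K3 ENGINE child, stub `stub_engine_scale0`, conjunct (E4)₀ `EngineFirstMoments … 0` — CLOSED under the DOORS `c ≤ klE4C₃ R`, `U ≤ klE4U₀ R`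
# (plan g16 (R29)): the smallness, the majorants and `T_X` discharged by name; `∃ E ≥ 0` R-INDEPENDENT

Cell `gate-hubbard-kl`, seat p4 (g9).  `…ScaleZeroE4Package.engineFirstMoments_zero_of_bounds` gives (E4)₀ under the stub binders from: a cutoff bound
`B` (here p3's `klCutoffX5`), majorants `Ā`, `k̄K`, two smallness conditions, the time-moment witness `C_T` (p4 g8) and the space moment `T_X ≤ X·(M/β)`.
This file discharges them under the doors of `…EngineV8DefsU6`:

* §1 regime algebra: `(n_β+1)U² ≤ c/log 4 ≤ 1/2`, `|Gfr j| = Gfr j` under `R.WF`, hence **`abar_le_klE4Abar`** (`Ā ≤ klE4Abar R`),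
  **`kKbar_le`** (`k̄K ≤ klE4KapF R·|U| + 2(c/log 4)·klE4Mom R`), **`thetaW_smallness_of_doors`** (the two smallness conditions), and
  **`spaceMoment_klAnisoFamily_zero_le_of_doors`**: k3c2-p1's `spaceMoment_klAnisoFamily_zero_le` at `B := klCutSqB5`, `W_A := klAngWA` with the
  `R`-dependent slope killed by the doors: `T_X ≤ 8(klE4X0 + 1)·(M/β)`;
* §2 **`engineFirstMoments_zero_of_doors`** — (E4)₀ under the stub binders + `c ≤ klE4C₃ R` + `U ≤ klE4U₀ R`, for every `G` with
  `16e⁹·(2·klIsoT + C_T + 8(klE4X0 + 1))⁴ ≤ G.cE4`; **`exists_engineFirstMoments_zero_of_doors`** — the `∃ E ≥ 0` form (E is `R`-INDEPENDENT: a closed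
  function of `klIsoT`, a `C_T` witness and `klE4X0`), i.e. the door-keyed twin of p3's `E4ScaleZeroAt` consumption.

Everything is proved; no definitions, no named facts, no sorry.  Nothing asserts superconductivity.
-/

noncomputable section

namespace Summit.HubbardSuperconductivity.HubbardSuperconductivity.Theorems.EngineV8

set_option linter.dupNamespace false -- summit = problem name (single-conjunct summit), D-0017

open Real Finset Complex Literature.MathematicalPhysics.QuantumLattice Literature.Probability.LatticeModels
open Literature.MathematicalPhysics.QuantumLattice.GrassmannAlgebra
open Summit.HubbardSuperconductivity.HubbardSuperconductivity.Theorems.KLRegimeSplit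
open Summit.HubbardSuperconductivity.HubbardSuperconductivity.Theorems.DispersionFlow
open Summit.HubbardSuperconductivity.HubbardSuperconductivity.Theorems.KLProgrammeLegKernels
open Summit.HubbardSuperconductivity.HubbardSuperconductivity.Theorems.ScaleZeroDecay
open scoped ComplexConjugate

/-! ## §1 Regime algebra under the doors -/

section Regime

variable {R : RenConsts} {U c β : ℝ}

/-- `klE4C₃ R ≤ log 4 / 2` (`klE4XSlope R ≥ 1`), so `c ≤ klE4C₃ R ⇒ c/log 4 ≤ 1/2`. -/
theorem div_log_four_le_half_of_door (hc : c ≤ klE4C₃ R) : c / Real.log 4 ≤ 1 / 2 := by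
  have h4 : 0 < Real.log 4 := Real.log_pos (by norm_num)
  have hX := one_le_klE4XSlope R
  have h1 : c ≤ Real.log 4 / (2 * klE4XSlope R) := hc.trans (min_le_right _ _)
  have h2 : Real.log 4 / (2 * klE4XSlope R) ≤ Real.log 4 / 2 :=
    div_le_div_of_nonneg_left h4.le (by norm_num) (by linarith)
  rw [div_le_iff₀ h4]
  linarith [h1.trans h2]

/-- In the regime: `(n_β + 1)·U² ≤ c/log 4`. -/
theorem nScales_succ_mul_sq_le (hc : 0 ≤ c) (hβ : klBetaMin ≤ β) (hβc : β ≤ Real.exp (c / U ^ 2)) :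
    (((nScales β : ℕ) : ℝ) + 1) * U ^ 2 ≤ c / Real.log 4 := by
  have h := PerturbedFermiCurve.sq_mul_nScales_succ_le hc hβ hβc
  linarith [h]

/-- **`Ā ≤ klE4Abar R`** under `R.WF`, `|U| ≤ 1`, `(n_β+1)U² ≤ 1/2`. -/
theorem abar_le_klE4Abar (hR : R.WF) (hU1 : |U| ≤ 1) {Nsc : ℕ} (hN : (((Nsc : ℕ) : ℝ) + 1) * U ^ 2 ≤ 1 / 2) :
    klScaleZeroA0 + uvTimeMomentConst klE0 7 32 +
        2 * (uvSpaceMomentConst klE0 1 (uvPieceSq klE0 (uvBaseQ klCutoffX5 klE0 4) (uvBaseQ' klCutoffX5 klE0 4)) +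
          (1 / 4 * Real.sqrt (216 * (1 / klE0 + 1 / 2)) *
              ∑ e : Fin 2 × Fin 2, (uvLinV klE0 (1 + (e.1 : ℕ) + (e.2 : ℕ)) *
                  (klCutoffX5 * ((1 + ((e.1 : ℕ) + (e.2 : ℕ)) + 2).factorial : ℝ) * (4 / klE0) ^ (1 + ((e.1 : ℕ) + (e.2 : ℕ)) + 1)) +
                uvLinD klE0 (1 + (e.1 : ℕ) + (e.2 : ℕ)) *
                  (klCutoffX5 * ((1 + ((e.1 : ℕ) + (e.2 : ℕ)) + 3).factorial : ℝ) * (4 / klE0) ^ (1 + ((e.1 : ℕ) + (e.2 : ℕ)) + 2)))) *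
            (4608 * (1 + R.Gfr 0 + R.Gfr 1 + R.Gfr 2 + R.Gfr 3) ^ 4 * ((((Nsc : ℕ) : ℝ) + 1) * U ^ 2 + 2 * |U|))) ≤ klE4Abar R := by
  have hG : ∀ j, 0 ≤ R.Gfr j := hR.2.2
  have he : (0 : ℝ) < klE0 := by norm_num [klE0]
  have hX5 : 1 ≤ klCutoffX5 := one_le_klCutoffX5
  have habs : ∀ j, |R.Gfr j| = R.Gfr j := fun j => abs_of_nonneg (hG j)
  refine le_trans ?_ (le_max_right _ _)
  rw [habs 0, habs 1, habs 2, habs 3]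
  have ht : (((Nsc : ℕ) : ℝ) + 1) * U ^ 2 + 2 * |U| ≤ 3 := by linarith [abs_nonneg U]
  have hS : 0 ≤ 4608 * (1 + R.Gfr 0 + R.Gfr 1 + R.Gfr 2 + R.Gfr 3) ^ 4 := by positivity
  have hC : 0 ≤ 1 / 4 * Real.sqrt (216 * (1 / klE0 + 1 / 2)) *
      ∑ e : Fin 2 × Fin 2, (uvLinV klE0 (1 + (e.1 : ℕ) + (e.2 : ℕ)) *
          (klCutoffX5 * ((1 + ((e.1 : ℕ) + (e.2 : ℕ)) + 2).factorial : ℝ) * (4 / klE0) ^ (1 + ((e.1 : ℕ) + (e.2 : ℕ)) + 1)) +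
        uvLinD klE0 (1 + (e.1 : ℕ) + (e.2 : ℕ)) *
          (klCutoffX5 * ((1 + ((e.1 : ℕ) + (e.2 : ℕ)) + 3).factorial : ℝ) * (4 / klE0) ^ (1 + ((e.1 : ℕ) + (e.2 : ℕ)) + 2))) := by
    refine mul_nonneg (by positivity) (sum_nonneg fun e _ => ?_)
    have h1 := uvLinV_nonneg he (1 + (e.1 : ℕ) + (e.2 : ℕ))
    have h2 := uvLinD_nonneg he (1 + (e.1 : ℕ) + (e.2 : ℕ))
    positivity
  have hmono : 4608 * (1 + R.Gfr 0 + R.Gfr 1 + R.Gfr 2 + R.Gfr 3) ^ 4 * ((((Nsc : ℕ) : ℝ) + 1) * U ^ 2 + 2 * |U|) ≤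
      4608 * (1 + R.Gfr 0 + R.Gfr 1 + R.Gfr 2 + R.Gfr 3) ^ 4 * 3 := mul_le_mul_of_nonneg_left ht hS
  nlinarith only [mul_le_mul_of_nonneg_left hmono hC]

/-- **`k̄K ≤ klE4KapF R·|U| + 2·(c/log 4)·klE4Mom R`** under `R.WF` and `(n_β+1)U² ≤ c/log 4`. -/
theorem kKbar_le (hR : R.WF) {Nsc : ℕ} (hN : (((Nsc : ℕ) : ℝ) + 1) * U ^ 2 ≤ c / Real.log 4) :
    klKappaFrameC R * |U| + 2 * ((((Nsc : ℕ) : ℝ) + 1) * U ^ 2 *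
        (6 * (Real.pi * R.Gfr 1 / 2 + Real.pi ^ 2 * R.Gfr 2 / (2 * Real.sqrt 2) + Real.pi ^ 3 * R.Gfr 3 / 8))) ≤
      klE4KapF R * |U| + 2 * (c / Real.log 4) * klE4Mom R := by
  have hG : ∀ j, 0 ≤ R.Gfr j := hR.2.2
  have habs : ∀ j, |R.Gfr j| = R.Gfr j := fun j => abs_of_nonneg (hG j)
  have hMom : 6 * (Real.pi * R.Gfr 1 / 2 + Real.pi ^ 2 * R.Gfr 2 / (2 * Real.sqrt 2) + Real.pi ^ 3 * R.Gfr 3 / 8) = klE4Mom R := by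
    rw [klE4Mom, habs 1, habs 2, habs 3]
  have hK : klKappaFrameC R ≤ klE4KapF R := by
    unfold klE4KapF; have := le_max_right 0 (klKappaFrameC R); linarith
  have hM0 := klE4Mom_nonneg R
  rw [hMom]
  nlinarith only [hK, hN, hM0, abs_nonneg U, mul_le_mul_of_nonneg_right hN hM0]

/-- **The two smallness conditions from the doors**: `U ≤ klE4U₀ R`, `c ≤ klE4C₃ R` (`0 < U`, `0 ≤ c`) give
`16e⁵·Ā·k̄K ≤ 1` and `64e⁹κ₀²·Ā·|U| ≤ 1` at `Ā := klE4Abar R`, `k̄K := klE4KapF R·|U| + 2(c/log 4)·klE4Mom R`. -/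
theorem thetaW_smallness_of_doors (hU : 0 < U) (hUD : U ≤ klE4U₀ R) (hc : 0 ≤ c) (hcD : c ≤ klE4C₃ R) :
    16 * Real.exp 1 ^ 5 * klE4Abar R * (klE4KapF R * |U| + 2 * (c / Real.log 4) * klE4Mom R) ≤ 1 ∧
      64 * Real.exp 1 ^ 9 * Real.sqrt (2 * (7 + 6047)) ^ 2 * klE4Abar R * |U| ≤ 1 := by
  have hA := klE4Abar_pos R
  have hKF : 1 ≤ klE4KapF R := one_le_klE4KapF R
  have hM0 := klE4Mom_nonneg R
  have h4 : 0 < Real.log 4 := Real.log_pos (by norm_num)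
  have he : 0 < Real.exp 1 := Real.exp_pos 1
  have he1 : 1 ≤ Real.exp 1 := Real.one_le_exp (by norm_num)
  have hκ2 : Real.sqrt (2 * (7 + 6047)) ^ 2 = 2 * (7 + 6047) := Real.sq_sqrt (by norm_num)
  have hUabs : |U| = U := abs_of_pos hU
  rw [hUabs, hκ2]
  -- the U-door
  have hU1 : U ≤ 1 / (128 * Real.exp 1 ^ 9 * (2 * (7 + 6047)) * klE4Abar R * klE4KapF R) := hUD.trans (min_le_left _ _)
  have hden1 : 0 < 128 * Real.exp 1 ^ 9 * (2 * (7 + 6047)) * klE4Abar R * klE4KapF R := by positivity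
  have hU1' : 128 * Real.exp 1 ^ 9 * (2 * (7 + 6047)) * klE4Abar R * klE4KapF R * U ≤ 1 := by
    rw [le_div_iff₀ hden1] at hU1; linarith
  -- the c-door
  have hc1 : c ≤ Real.log 4 / (128 * Real.exp 1 ^ 5 * klE4Abar R * (klE4Mom R + 1)) := hcD.trans (min_le_left _ _)
  have hden2 : 0 < 128 * Real.exp 1 ^ 5 * klE4Abar R * (klE4Mom R + 1) := by positivity
  have hc1' : 128 * Real.exp 1 ^ 5 * klE4Abar R * (klE4Mom R + 1) * (c / Real.log 4) ≤ 1 := by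
    rw [le_div_iff₀ hden2] at hc1
    rw [show 128 * Real.exp 1 ^ 5 * klE4Abar R * (klE4Mom R + 1) * (c / Real.log 4) =
      128 * Real.exp 1 ^ 5 * klE4Abar R * (klE4Mom R + 1) * c / Real.log 4 by ring, div_le_one h4]
    linarith
  have he4 : 1 ≤ Real.exp 1 ^ 4 := one_le_pow₀ he1
  have hcl : 0 ≤ c / Real.log 4 := div_nonneg hc h4.le
  constructor
  · -- 16e⁵ĀKapF·U ≤ 1/8 and 32e⁵Ā(c/log4)Mom ≤ 1/4
    have t1 : 16 * Real.exp 1 ^ 5 * klE4Abar R * (klE4KapF R * U) ≤ 1 / 8 := by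
      have : 16 * Real.exp 1 ^ 5 * klE4Abar R * (klE4KapF R * U) * (8 * Real.exp 1 ^ 4 * (2 * (7 + 6047))) =
          128 * Real.exp 1 ^ 9 * (2 * (7 + 6047)) * klE4Abar R * klE4KapF R * U := by ring
      have hpos : 0 ≤ 16 * Real.exp 1 ^ 5 * klE4Abar R * (klE4KapF R * U) := by positivity
      nlinarith only [this, hU1', hpos, he4]
    have t2 : 16 * Real.exp 1 ^ 5 * klE4Abar R * (2 * (c / Real.log 4) * klE4Mom R) ≤ 1 / 4 := by
      have : 16 * Real.exp 1 ^ 5 * klE4Abar R * (2 * (c / Real.log 4) * klE4Mom R) * 4 ≤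
          128 * Real.exp 1 ^ 5 * klE4Abar R * (klE4Mom R + 1) * (c / Real.log 4) := by
        have h0 : 0 ≤ 128 * Real.exp 1 ^ 5 * klE4Abar R * (c / Real.log 4) := by positivity
        nlinarith only [h0, hM0]
      linarith
    calc 16 * Real.exp 1 ^ 5 * klE4Abar R * (klE4KapF R * U + 2 * (c / Real.log 4) * klE4Mom R)
        = 16 * Real.exp 1 ^ 5 * klE4Abar R * (klE4KapF R * U) + 16 * Real.exp 1 ^ 5 * klE4Abar R * (2 * (c / Real.log 4) * klE4Mom R) := by
          ring
      _ ≤ 1 / 8 + 1 / 4 := add_le_add t1 t2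
      _ ≤ 1 := by norm_num
  · have : 64 * Real.exp 1 ^ 9 * (2 * (7 + 6047)) * klE4Abar R * U * (2 * klE4KapF R) =
        128 * Real.exp 1 ^ 9 * (2 * (7 + 6047)) * klE4Abar R * klE4KapF R * U := by ring
    have hpos : 0 ≤ 64 * Real.exp 1 ^ 9 * (2 * (7 + 6047)) * klE4Abar R * U := by positivity
    nlinarith only [this, hU1', hpos, hKF]

end Regime

/-! ## §2 `T_X` under the doors and the closed (E4)₀ -/

section Main

/-- **`T_X ≤ 8(klE4X0 + 1)·(M/β)` under the doors**: k3c2-p1's `spaceMoment_klAnisoFamily_zero_le` at `B := klCutSqB5`, `W_A := klAngWA`, with the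
`R`-dependent slope `klE4XSlope R·((n_β+1)U² + 2|U|) ≤ 3/4` by `c ≤ klE4C₃ R`, `U ≤ klE4U₀ R`. -/
theorem spaceMoment_klAnisoFamily_zero_le_of_doors {L M : ℕ} [NeZero L] [NeZero M] {R : RenConsts} {U μ β c : ℝ} {K : TrigPolyC4v}
    (hK : FrameOK R U (nScales β) μ K) (hRwf : R.WF) (hU : 0 < U) (hU1 : |U| ≤ 1) (hUD : U ≤ klE4U₀ R) (hc : 0 ≤ c) (hcD : c ≤ klE4C₃ R)
    (hμ : μ ∈ klWindowC) (hκU : 16 / 15 * (R.Gfr 0 * |U|) ≤ 1 / 50) (hL : (2 : ℝ) ^ 15 ≤ L) (hβ : klBetaMin ≤ β)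
    (hβc : β ≤ Real.exp (c / U ^ 2)) (hβM : β ^ 3 ≤ (M : ℝ)) (ω : Fin (sectorCount 0)) (c' : Fin 2) :
    1 / (|β| * (L : ℝ) ^ 2) *
        ∑ dw : TorusSite 1 (2 * (2 * M)) × TorusSite 2 L,
          torusSiteDist dw.2 0 *
            ‖∑ k : FreqMomentum L M, klAnisoFamily L M β μ K klE0 0 ω k *
              (if c' = 0 then torusChar (fun _ : Fin 1 => ((k.1 : ℕ) : ZMod (2 * (2 * M)))) dw.1 * torusChar k.2 dw.2
                else conj (torusChar (fun _ : Fin 1 => ((k.1 : ℕ) : ZMod (2 * (2 * M)))) dw.1 * torusChar k.2 dw.2))‖ ≤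
      8 * (klE4X0 + 1) * (M / β) := by
  have hG : ∀ j, 0 ≤ R.Gfr j := hRwf.2.2
  have habs : ∀ j, |R.Gfr j| = R.Gfr j := fun j => abs_of_nonneg (hG j)
  have he : (0 : ℝ) < klE0 := by norm_num [klE0]
  have he2 : (0 : ℝ) < 2 * klE0 := by positivity
  have hβ0 : 0 < β := beta_pos_of_klBetaMin_le hβ
  have hM0 : (0 : ℝ) < M := by exact_mod_cast Nat.pos_of_ne_zero (NeZero.ne M)
  have h := spaceMoment_klAnisoFamily_zero_le hK hRwf hU1 hμ hκU hL hβ hβM one_le_klCutSqB5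
    norm_iteratedDeriv_bgmCutoffSqUnit_le_klCutSqB5 klAngWA_nonneg norm_iteratedFDeriv_zoneAngularRaw_le_klAngWA ω c'
  refine h.trans ?_
  -- the slope
  set t : ℝ := (((nScales β : ℕ) : ℝ) + 1) * U ^ 2 + 2 * (|U|) with ht
  set X1 : ℝ := (1 / 4 * Real.sqrt (216 * (1 / (2 * klE0) + 1 / 2)) *
          ∑ e : Fin 2 × Fin 2, (uvLinV (2 * klE0) (1 + (e.1 : ℕ) + (e.2 : ℕ)) *
              (klE0 / 2 * (((1 + ((e.1 : ℕ) + (e.2 : ℕ)) + 1).factorial : ℝ) * klCutSqB5 * (2 / klE0) ^ (1 + ((e.1 : ℕ) + (e.2 : ℕ)) + 1))) +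
            uvLinD (2 * klE0) (1 + (e.1 : ℕ) + (e.2 : ℕ)) *
              (klE0 / 2 * (((1 + ((e.1 : ℕ) + (e.2 : ℕ)) + 2).factorial : ℝ) * klCutSqB5 * (2 / klE0) ^ (1 + ((e.1 : ℕ) + (e.2 : ℕ)) + 2))))) with hX1
  have hX1nn : 0 ≤ X1 := by
    have hB : 0 ≤ klCutSqB5 := zero_le_one.trans one_le_klCutSqB5
    refine mul_nonneg (by positivity) (sum_nonneg fun e _ => ?_)
    have h1 := uvLinV_nonneg he2 (1 + (e.1 : ℕ) + (e.2 : ℕ))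
    have h2 := uvLinD_nonneg he2 (1 + (e.1 : ℕ) + (e.2 : ℕ))
    positivity
  have hslope : X1 * (klAngWA * (36864 * (1 + R.Gfr 0 + R.Gfr 1 + R.Gfr 2 + R.Gfr 3) ^ 4)) ≤ klE4XSlope R := by
    refine le_trans (le_of_eq ?_) (le_max_right _ _)
    rw [habs 0, habs 1, habs 2, habs 3]
  have hXS := klE4XSlope_pos R
  have hXS1 := one_le_klE4XSlope R
  -- `t ≤ c/log 4 + 2U` and the doors
  have hUabs : |U| = U := abs_of_pos hU
  have hN := nScales_succ_mul_sq_le (U := U) hc hβ hβc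
  have h4 : 0 < Real.log 4 := Real.log_pos (by norm_num)
  have hc1 : c ≤ Real.log 4 / (2 * klE4XSlope R) := hcD.trans (min_le_right _ _)
  have hc1' : klE4XSlope R * (c / Real.log 4) ≤ 1 / 2 := by
    rw [le_div_iff₀ (by positivity)] at hc1
    rw [show klE4XSlope R * (c / Real.log 4) = klE4XSlope R * c / Real.log 4 by ring, div_le_iff₀ h4]
    linarith
  have hU2 : U ≤ 1 / (8 * klE4XSlope R) := hUD.trans (min_le_right _ _)
  have hU2' : klE4XSlope R * (2 * U) ≤ 1 / 4 := by
    rw [le_div_iff₀ (by positivity)] at hU2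
    linarith
  have htle : klE4XSlope R * t ≤ 3 / 4 := by
    rw [ht, hUabs]
    have : klE4XSlope R * ((((nScales β : ℕ) : ℝ) + 1) * U ^ 2) ≤ klE4XSlope R * (c / Real.log 4) :=
      mul_le_mul_of_nonneg_left hN hXS.le
    nlinarith only [this, hc1', hU2']
  have ht0 : 0 ≤ t := by rw [ht]; positivity
  have hkey : X1 * (klAngWA * (36864 * (1 + R.Gfr 0 + R.Gfr 1 + R.Gfr 2 + R.Gfr 3) ^ 4 * t)) ≤ 3 / 4 := by
    have : X1 * (klAngWA * (36864 * (1 + R.Gfr 0 + R.Gfr 1 + R.Gfr 2 + R.Gfr 3) ^ 4 * t)) =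
        X1 * (klAngWA * (36864 * (1 + R.Gfr 0 + R.Gfr 1 + R.Gfr 2 + R.Gfr 3) ^ 4)) * t := by ring
    rw [this]
    exact (mul_le_mul_of_nonneg_right hslope ht0).trans htle
  have hX0 : 0 ≤ klE4X0 := uvSpaceMomentConst_nonneg _ _ _
  have h8 : 0 ≤ 8 * (M : ℝ) / β := by positivity
  calc 8 * (M : ℝ) / β * (klE4X0 + X1 * (klAngWA * (36864 * (1 + R.Gfr 0 + R.Gfr 1 + R.Gfr 2 + R.Gfr 3) ^ 4 * t)))
      ≤ 8 * (M : ℝ) / β * (klE4X0 + 3 / 4) := mul_le_mul_of_nonneg_left (by linarith) h8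
    _ ≤ 8 * (klE4X0 + 1) * (M / β) := by
        rw [show 8 * (klE4X0 + 1) * ((M : ℝ) / β) = 8 * (M : ℝ) / β * (klE4X0 + 1) by ring]
        exact mul_le_mul_of_nonneg_left (by linarith) h8

/-- **(E4)₀ CLOSED under the doors** (plan g16 (R29)): under the binders of `stub_engine_scale0` (`klEngU₀3`-keyed) and the doors `c ≤ klE4C₃ R`,
`U ≤ klE4U₀ R`, given a time-moment witness `C_T` (p4 g8's `exists_timeMomentConst_klAnisoFamily_zero`):
`EngineFirstMoments L M G P (klEngQ5 P R) β U μ K 0` for every `G` with `16e⁹·(2·klIsoT + C_T + 8(klE4X0 + 1))⁴ ≤ G.cE4`. -/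
theorem engineFirstMoments_zero_of_doors {C_T : ℝ} (hCT0 : 0 ≤ C_T)
    (hCT : ∀ (L M : ℕ) [NeZero L] [NeZero M] (R : RenConsts) (U : ℝ) (N : ℕ) (μ : ℝ) (K : TrigPolyC4v),
      FrameOK R U N μ K → (∀ j, 0 ≤ R.Gfr j) → μ ∈ klWindowC → 16 / 15 * (R.Gfr 0 * |U|) ≤ 1 / 50 → (2 : ℝ) ^ 15 ≤ L →
      ∀ β : ℝ, klBetaMin ≤ β → β ≤ M → klE0 * β ≤ Real.pi * (2 * M - 13) →
      ∀ (ω : Fin (sectorCount 0)) (c : Fin 2),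
        1 / (|β| * (L : ℝ) ^ 2) *
            ∑ dw : TorusSite 1 (2 * (2 * M)) × TorusSite 2 L,
              (β / (2 * (2 * M) : ℕ) * cyclicDist (2 * (2 * M)) (dw.1 0) 0) *
                ‖∑ k : FreqMomentum L M, klAnisoFamily L M β μ K klE0 0 ω k *
                  (if c = 0 then torusChar (fun _ : Fin 1 => ((k.1 : ℕ) : ZMod (2 * (2 * M)))) dw.1 * torusChar k.2 dw.2
                    else conj (torusChar (fun _ : Fin 1 => ((k.1 : ℕ) : ZMod (2 * (2 * M)))) dw.1 * torusChar k.2 dw.2))‖ ≤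
          C_T * (M / β))
    (G : GeoConsts) (hGE : 16 * Real.exp 1 ^ 9 * (2 * klIsoT + C_T + 8 * (klE4X0 + 1)) ^ 4 ≤ G.cE4)
    (P : SplitConsts) (R : RenConsts) (c : ℝ) (hP : P.WF) (hR : R.WF2) (hc : 0 < c) (hc₃ : c ≤ klEngC₃3 P R) (hcD : c ≤ klE4C₃ R)
    (μ : ℝ) (hμ : μ ∈ klWindowC) (U : ℝ) (hU : 0 < U) (hU₀ : U ≤ klEngU₀3 P R c) (hUD : U ≤ klE4U₀ R) (β : ℝ) (hβ : klBetaMin ≤ β)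
    (hβc : β ≤ Real.exp (c / U ^ 2)) (K : TrigPolyC4v) (hK : FrameOK R U (nScales β) μ K) (L M : ℕ) [NeZero L] [NeZero M]
    (hL : klEngL₃ β U ≤ L) (hM : klEngM₃ β U L ≤ M) :
    EngineFirstMoments L M G P (klEngQ5 P R) β U μ K 0 := by
  have hRwf : R.WF := hR.wf
  have hU1 : |U| ≤ 1 := abs_le_one_of_le_klEngU₀3 hU hU₀
  have hκU : 16 / 15 * (R.Gfr 0 * |U|) ≤ 1 / 50 := gfr0_abs_mul_le_of_le_klEngU₀3 hU hU₀
  obtain ⟨hL15, -, -, -, hβ3M, -⟩ := scaleZero_regime_sizes hβ hL hM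
  have hN := nScales_succ_mul_sq_le (U := U) hc.le hβ hβc
  have hhalf := div_log_four_le_half_of_door hcD
  obtain ⟨hθ1, hθ2⟩ := thetaW_smallness_of_doors (R := R) hU hUD hc.le hcD
  have hX0 : 0 ≤ klE4X0 := uvSpaceMomentConst_nonneg _ _ _
  exact engineFirstMoments_zero_of_bounds hCT0 hCT (X := 8 * (klE4X0 + 1)) (by positivity) G hGE P R c hP hR hc hc₃ μ hμ U hU hU₀ β
    hβ hβc K hK L M hL hM one_le_klCutoffX5 norm_iteratedDeriv_salmhoferCutoff_le_klCutoffX5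
    (Abar := klE4Abar R) (abar_le_klE4Abar hRwf hU1 (hN.trans hhalf))
    (kKbar := klE4KapF R * |U| + 2 * (c / Real.log 4) * klE4Mom R) (kKbar_le hRwf hN) hθ1 hθ2
    (fun ω c' => spaceMoment_klAnisoFamily_zero_le_of_doors hK hRwf hU hU1 hUD hc.le hcD hμ hκU hL15 hβ hβc hβ3M ω c')

/-- **`EngineFirstMoments` is monotone in the two constants it reads** (`G.cE4`, `Q.cE4`; `0 ≤ P.Klam`). -/
theorem engineFirstMoments_mono_cE4 {L M : ℕ} [NeZero L] [NeZero M] {G G' : GeoConsts} {P : SplitConsts} {Q Q' : EngConsts}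
    {β U μ : ℝ} {K : TrigPolyC4v} {n : ℕ} (hG : G.cE4 ≤ G'.cE4) (hQ : Q.cE4 ≤ Q'.cE4) (hKlam : 0 ≤ P.Klam)
    (h : EngineFirstMoments L M G P Q β U μ K n) : EngineFirstMoments L M G' P Q' β U μ K n := by
  intro Ω i k
  refine (h Ω i k).trans ?_
  have hU := abs_nonneg U
  have h1 : G.cE4 + Q.cE4 * |U| ≤ G'.cE4 + Q'.cE4 * |U| := by nlinarith only [hG, hQ, hU]
  have h2 : 0 ≤ P.Klam * |U| * (4 : ℝ) ^ n := by positivity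
  calc (G.cE4 + Q.cE4 * |U|) * P.Klam * |U| * (4 : ℝ) ^ n = (G.cE4 + Q.cE4 * |U|) * (P.Klam * |U| * (4 : ℝ) ^ n) := by ring
    _ ≤ (G'.cE4 + Q'.cE4 * |U|) * (P.Klam * |U| * (4 : ℝ) ^ n) := mul_le_mul_of_nonneg_right h1 h2
    _ = (G'.cE4 + Q'.cE4 * |U|) * P.Klam * |U| * (4 : ℝ) ^ n := by ring

/-- **(E4)₀ CLOSED under the doors, `∃ E ≥ 0` form with `E` INDEPENDENT of `R`, for EVERY `G`, `Q` with `E ≤ G.cE4`, `(klEngQ5 P R).cE4 ≤ Q.cE4`**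
(door-keyed twin of p3's `E4ScaleZeroAt` consumption): under the binders of `stub_engine_scale0` (`klEngC₃3`/`klEngU₀3`) and the doors
`c ≤ klE4C₃ R`, `U ≤ klE4U₀ R`, `EngineFirstMoments L M G P Q β U μ K 0`. -/
theorem exists_engineFirstMoments_zero_of_doors :
    ∃ E : ℝ, 0 ≤ E ∧ ∀ (G : GeoConsts) (P : SplitConsts) (R : RenConsts) (Q : EngConsts), E ≤ G.cE4 → (klEngQ5 P R).cE4 ≤ Q.cE4 →
      ∀ c : ℝ, P.WF → R.WF2 → 0 < c → c ≤ klEngC₃3 P R → c ≤ klE4C₃ R →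
      ∀ μ ∈ klWindowC, ∀ U : ℝ, 0 < U → U ≤ klEngU₀3 P R c → U ≤ klE4U₀ R →
      ∀ β : ℝ, klBetaMin ≤ β → β ≤ Real.exp (c / U ^ 2) → ∀ K : TrigPolyC4v, FrameOK R U (nScales β) μ K →
      ∀ (L M : ℕ) [NeZero L] [NeZero M], klEngL₃ β U ≤ L → klEngM₃ β U L ≤ M →
        EngineFirstMoments L M G P Q β U μ K 0 := by
  obtain ⟨C_T, hCT0, hCT⟩ := exists_timeMomentConst_klAnisoFamily_zero
  have hX0 : 0 ≤ klE4X0 := uvSpaceMomentConst_nonneg _ _ _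
  refine ⟨16 * Real.exp 1 ^ 9 * (2 * klIsoT + C_T + 8 * (klE4X0 + 1)) ^ 4, by have := klIsoT_nonneg; positivity, ?_⟩
  intro G P R Q hGE hQ c hP hR hc hc₃ hcD μ hμ U hU hU₀ hUD β hβ hβc K hK L M _ _ hL hM
  have h := engineFirstMoments_zero_of_doors hCT0 hCT G hGE P R c hP hR hc hc₃ hcD μ hμ U hU hU₀ hUD β hβ hβc K hK L M hL hM
  exact engineFirstMoments_mono_cE4 le_rfl hQ (zero_le_one.trans hP.1) h

/-- **(E4)₀ at the REGISTRATION thresholds `klEngC₃6`, `klEngU₀6`** (one `le_trans` per door), every `G`, `Q` as above. -/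
theorem exists_engineFirstMoments_zero_klEng6 :
    ∃ E : ℝ, 0 ≤ E ∧ ∀ (G : GeoConsts) (P : SplitConsts) (R : RenConsts) (Q : EngConsts), E ≤ G.cE4 → (klEngQ5 P R).cE4 ≤ Q.cE4 →
      ∀ c : ℝ, P.WF → R.WF2 → 0 < c → c ≤ klEngC₃6 P R →
      ∀ μ ∈ klWindowC, ∀ U : ℝ, 0 < U → U ≤ klEngU₀6 P R c →
      ∀ β : ℝ, klBetaMin ≤ β → β ≤ Real.exp (c / U ^ 2) → ∀ K : TrigPolyC4v, FrameOK R U (nScales β) μ K →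
      ∀ (L M : ℕ) [NeZero L] [NeZero M], klEngL₃ β U ≤ L → klEngM₃ β U L ≤ M →
        EngineFirstMoments L M G P Q β U μ K 0 := by
  obtain ⟨E, hE0, h⟩ := exists_engineFirstMoments_zero_of_doors
  refine ⟨E, hE0, ?_⟩
  intro G P R Q hGE hQ c hP hR hc hc6 μ hμ U hU hU6 β hβ hβc K hK L M _ _ hL hM
  exact h G P R Q hGE hQ c hP hR hc (hc6.trans (klEngC₃6_le_klEngC₃3 P R)) (hc6.trans (klEngC₃6_le_klE4C₃ P R)) μ hμ U hU
    (hU6.trans (klEngU₀6_le_klEngU₀3 P R c)) (hU6.trans (klEngU₀6_le_klE4U₀ P R c)) β hβ hβc K hK L M hL hM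

end Main

end Summit.HubbardSuperconductivity.HubbardSuperconductivity.Theorems.EngineV8

end
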